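import Summits.HodgeConjecture.CorCM.IrreducibleOddWeightsIsotypicCells
import HarnessLib

/-!
# Isotypic cells, II: JORDAN–HÖLDER-lite and CROSS-TYPE INDEPENDENCE — an irreducible stable subspace of a sum of
# irreducibles is equivariantly isomorphic to one of them; sums of irreducibles of NON-ISOMORPHIC types meet trivially

COR-CM (cell `pub-hodgecm2`, binder seat `b16` gen 70, count-neutral claim ISOTYPIC SPLITTING OF THE DEFECT, file I2 —
pure linear algebra; theorems only, no definition, no named fact, no `sorry`).  NEW as organised here, hence under
`Summits/`.  HONEST FRAMING: continuation of file I1 (`IrreducibleOddWeightsIsotypicCells`): one ℚ-space `V`, a family of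
operators `T_i`, STABLE and IRREDUCIBLE subspaces in the lane's unbundled shape.  An EQUIVARIANT ISOMORPHISM `N → N′` is
spelled as a linear `P : V → V` with `P(N) ⊆ N′`, injective on `N`, onto `N′`, and `P (T_i v) = T_i (P v)` on `N`.
`HC_CM` is neither used nor asserted.

* §1 **JORDAN–HÖLDER-lite** (`exists_iso_of_irreducible_le_iSup`): `N_s` stable irreducible (`s ∈ σ` finite), `M` stable
  irreducible non-zero with `M ≤ Σ_s N_s` ⟹ for some `s₀` with `N_{s₀} ≠ 0` the projection onto `M` along a complementary
  sub-sum (file I1 §3, §5) restricts to an equivariant isomorphism **`N_{s₀} ≅ M`**.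
* §2 **INVERSES** (`exists_inverse_of_iso`): an equivariant isomorphism `N → N′` has an equivariant inverse `N′ → N`.
* §3 **CROSS-TYPE INDEPENDENCE** (`iSup_inf_iSup_eq_bot_of_forall_not_iso`): two finite families `N_s`, `N′_t` of stable
  irreducibles such that NO non-zero `N_s` is equivariantly isomorphic to an `N′_t` ⟹ **`(Σ_s N_s) ⊓ (Σ_t N′_t) = 0`** (a
  non-zero meet contains an irreducible, isomorphic to some `N_{s₀}` and to some `N′_{t₀}` by §1).
The lane uses §3 for the coefficient containers of non-isomorphic shadow modules (file I3).

## References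

* [Serre1977] J.-P. Serre, *Linear Representations of Finite Groups*, GTM 42, §2.2 (Schur's lemma), §2.6 (canonical
  decomposition).
* [Lang2002] S. Lang, *Algebra*, 3rd ed., XVII §1 Prop. 1.1 and XVII §2.
* [CurtisReiner1962] C. W. Curtis, I. Reiner, *Representation Theory of Finite Groups and Associative Algebras*, §15.
-/

set_option autoImplicit false

noncomputable section

open scoped BigOperators Classical

universe u u' v w

namespace Summit.HodgeConjecture.CorCM.IrrOdd

variable {V : Type v} [AddCommGroup V] [Module ℚ V] {ι : Type w} (T : ι → V →ₗ[ℚ] V)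

/-! ### §1 Jordan–Hölder-lite -/

/-- **JORDAN–HÖLDER-lite.**  `N_s` (`s ∈ σ` finite) stable irreducible, `M ≠ 0` stable irreducible with `M ≤ Σ_s N_s`.
Then some `N_{s₀} ≠ 0` is EQUIVARIANTLY ISOMORPHIC to `M`: there is a linear `P : V → V` mapping `N_{s₀}` into `M`,
injective on `N_{s₀}`, onto `M`, commuting with every `T_i` on `N_{s₀}` (the projection onto `M` along a complementary
sub-sum `Σ_{s∈S} N_s`, restricted to an `N_{s₀}` outside that sub-sum). [cite: Serre1977, §2.2 and §2.6]
[cite: Lang2002, XVII §1 Prop. 1.1] -/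
theorem exists_iso_of_irreducible_le_iSup {σ : Type u} [Fintype σ] {N : σ → Submodule ℚ V}
    [∀ s, FiniteDimensional ℚ (N s)]
    (hNst : ∀ (s : σ) (i : ι) (v : V), v ∈ N s → T i v ∈ N s)
    (hNirr : ∀ (s : σ) (W : Submodule ℚ V), W ≤ N s → W ≠ ⊥ →
      (∀ (i : ι) (v : V), v ∈ W → T i v ∈ W) → W = N s)
    {M : Submodule ℚ V} [FiniteDimensional ℚ M] (hMst : ∀ (i : ι) (v : V), v ∈ M → T i v ∈ M)
    (hMirr : ∀ W : Submodule ℚ V, W ≤ M → W ≠ ⊥ → (∀ (i : ι) (v : V), v ∈ W → T i v ∈ W) → W = M)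
    (hM0 : M ≠ ⊥) (hM : M ≤ ⨆ s, N s) :
    ∃ s₀ : σ, N s₀ ≠ ⊥ ∧ ∃ P : V →ₗ[ℚ] V, (∀ v ∈ N s₀, P v ∈ M) ∧ (∀ v ∈ N s₀, P v = 0 → v = 0) ∧
      (∀ m ∈ M, ∃ v ∈ N s₀, P v = m) ∧ ∀ (i : ι) (v : V), v ∈ N s₀ → P (T i v) = T i (P v) := by
  obtain ⟨S, hdisj, hsup, -⟩ := exists_finset_compl_of_stable_le_iSup T hNst hNirr hMst hM
  have hQst := stable_finset_sup T N hNst S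
  -- some `N s₀` is not below the complementary sub-sum `Q = S.sup N`
  have hex : ∃ s₀, ¬ N s₀ ≤ S.sup N := by
    by_contra hall
    push Not at hall
    have hQ : S.sup N = ⨆ s, N s := le_antisymm (Finset.sup_le fun s _ => le_iSup N s) (iSup_le hall)
    apply hM0
    rw [← hdisj, eq_comm, inf_eq_left, hQ]
    exact hM
  obtain ⟨s₀, hs₀⟩ := hex
  have hs₀0 : N s₀ ≠ ⊥ := fun h => hs₀ (h ▸ bot_le)
  have hmeet : N s₀ ⊓ S.sup N = ⊥ := inf_eq_bot_of_irreducible_of_not_le T (hNst s₀) (hNirr s₀) hQst hs₀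
  obtain ⟨π, hπM, -, -, hπker, hπeq⟩ := exists_proj_of_inf_eq_bot T hMst hQst hdisj
  have hle : N s₀ ≤ M ⊔ S.sup N := by
    rw [hsup]
    exact le_iSup N s₀
  -- `π` is injective on `N s₀`
  have hinj : ∀ v ∈ N s₀, π v = 0 → v = 0 := by
    intro v hv h0
    have hvQ : v ∈ S.sup N := by simpa [h0] using hπker v (hle hv)
    have hv' : v ∈ N s₀ ⊓ S.sup N := ⟨hv, hvQ⟩
    rwa [hmeet, Submodule.mem_bot] at hv'
  -- the image of `N s₀` is a non-zero stable subspace of the irreducible `M`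
  have himage : (N s₀).map π = M := by
    refine hMirr _ (fun x hx => ?_) ?_ ?_
    · obtain ⟨v, -, rfl⟩ := Submodule.mem_map.1 hx
      exact hπM v
    · intro h
      apply hs₀0
      rw [eq_bot_iff]
      intro v hv
      have hπv : π v ∈ (N s₀).map π := Submodule.mem_map_of_mem hv
      rw [h, Submodule.mem_bot] at hπv
      rw [Submodule.mem_bot]
      exact hinj v hv hπv
    · intro i x hx
      obtain ⟨v, hv, rfl⟩ := Submodule.mem_map.1 hx
      rw [← hπeq i v (hle hv)]
      exact Submodule.mem_map_of_mem (hNst s₀ i v hv)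
  refine ⟨s₀, hs₀0, π, fun v _ => hπM v, hinj, fun m hm => ?_, fun i v hv => hπeq i v (hle hv)⟩
  rw [← himage] at hm
  obtain ⟨v, hv, rfl⟩ := Submodule.mem_map.1 hm
  exact ⟨v, hv, rfl⟩

/-! ### §2 Inverses -/

/-- **INVERSES.**  An equivariant isomorphism `P : N → N′` (`N` stable) has an equivariant inverse `P′ : N′ → N`:
`P′(N′) ⊆ N`, injective on `N′`, onto `N`, `P′ ∘ P = id` on `N`, `P ∘ P′ = id` on `N′`, commuting with the `T_i` on `N′`.
[cite: Serre1977, §2.2] -/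
theorem exists_inverse_of_iso {N N' : Submodule ℚ V} (P : V →ₗ[ℚ] V)
    (hNst : ∀ (i : ι) (v : V), v ∈ N → T i v ∈ N)
    (hPN : ∀ v ∈ N, P v ∈ N') (hPinj : ∀ v ∈ N, P v = 0 → v = 0) (hPsurj : ∀ v' ∈ N', ∃ v ∈ N, P v = v')
    (hPeq : ∀ (i : ι) (v : V), v ∈ N → P (T i v) = T i (P v)) :
    ∃ P' : V →ₗ[ℚ] V, (∀ v' ∈ N', P' v' ∈ N) ∧ (∀ v' ∈ N', P' v' = 0 → v' = 0) ∧
      (∀ v ∈ N, ∃ v' ∈ N', P' v' = v) ∧ (∀ (i : ι) (v' : V), v' ∈ N' → P' (T i v') = T i (P' v')) ∧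
      (∀ v ∈ N, P' (P v) = v) ∧ ∀ v' ∈ N', P (P' v') = v' := by
  -- the restriction `f : N → N'` is a linear bijection
  let f : N →ₗ[ℚ] N' := LinearMap.codRestrict N' (P.domRestrict N) fun v => hPN v v.2
  have hf : ∀ v : N, (f v : V) = P v := fun v => rfl
  have hfinj : Function.Injective f := by
    intro a b hab
    apply Subtype.ext
    have h := congrArg (fun x : N' => (x : V)) hab
    simp only [hf] at h
    have h0 : P ((a : V) - b) = 0 := by rw [map_sub, h, sub_self]
    exact sub_eq_zero.1 (hPinj _ (N.sub_mem a.2 b.2) h0)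
  have hfsurj : Function.Surjective f := by
    intro v'
    obtain ⟨v, hv, hPv⟩ := hPsurj v' v'.2
    exact ⟨⟨v, hv⟩, Subtype.ext (by rw [hf]; exact hPv)⟩
  let e : N ≃ₗ[ℚ] N' := LinearEquiv.ofBijective f ⟨hfinj, hfsurj⟩
  have he : ∀ v : N, (e v : V) = P v := fun v => rfl
  obtain ⟨P', hP'⟩ := LinearMap.exists_extend (N.subtype ∘ₗ (e.symm : N' →ₗ[ℚ] N))
  have hP'apply : ∀ v' : N', P' v' = (e.symm v' : V) := fun v' => by
    have h := LinearMap.congr_fun hP' v'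
    simpa using h
  have hleft : ∀ v ∈ N, P' (P v) = v := by
    intro v hv
    rw [← he ⟨v, hv⟩, hP'apply, LinearEquiv.symm_apply_apply]
  have hright : ∀ v' ∈ N', P (P' v') = v' := by
    intro v' hv'
    rw [hP'apply ⟨v', hv'⟩, ← he, LinearEquiv.apply_symm_apply]
  have hmem : ∀ v' ∈ N', P' v' ∈ N := fun v' hv' => by
    rw [hP'apply ⟨v', hv'⟩]
    exact Submodule.coe_mem _
  refine ⟨P', hmem, fun v' hv' h0 => ?_, fun v hv => ⟨P v, hPN v hv, hleft v hv⟩, fun i v' hv' => ?_,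
    hleft, hright⟩
  · rw [← hright v' hv', h0, map_zero]
  · have hv : P' v' ∈ N := hmem v' hv'
    conv_lhs => rw [← hright v' hv', ← hPeq i _ hv]
    exact hleft _ (hNst i _ hv)

/-! ### §3 Cross-type independence -/

/-- **CROSS-TYPE INDEPENDENCE.**  Two finite families `N_s`, `N′_t` of stable irreducible subspaces such that no
non-zero `N_s` is equivariantly isomorphic to an `N′_t`.  Then **`(Σ_s N_s) ⊓ (Σ_t N′_t) = 0`**: a non-zero meet is stable
and finite-dimensional, so it contains a stable irreducible `M ≠ 0` (file I1 §2), which by Jordan–Hölder-lite is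
isomorphic to some `N_{s₀}` and to some `N′_{t₀}` — composing gives `N_{s₀} ≅ N′_{t₀}`. [cite: Serre1977, §2.6]
[cite: Lang2002, XVII §2] -/
theorem iSup_inf_iSup_eq_bot_of_forall_not_iso {σ : Type u} {σ' : Type u'} [Fintype σ] [Fintype σ']
    {N : σ → Submodule ℚ V} {N' : σ' → Submodule ℚ V}
    [∀ s, FiniteDimensional ℚ (N s)] [∀ t, FiniteDimensional ℚ (N' t)]
    (hNst : ∀ (s : σ) (i : ι) (v : V), v ∈ N s → T i v ∈ N s)
    (hNirr : ∀ (s : σ) (W : Submodule ℚ V), W ≤ N s → W ≠ ⊥ →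
      (∀ (i : ι) (v : V), v ∈ W → T i v ∈ W) → W = N s)
    (hN'st : ∀ (t : σ') (i : ι) (v : V), v ∈ N' t → T i v ∈ N' t)
    (hN'irr : ∀ (t : σ') (W : Submodule ℚ V), W ≤ N' t → W ≠ ⊥ →
      (∀ (i : ι) (v : V), v ∈ W → T i v ∈ W) → W = N' t)
    (hsep : ∀ (s : σ) (t : σ'), N s ≠ ⊥ → ∀ P : V →ₗ[ℚ] V, (∀ v ∈ N s, P v ∈ N' t) →
      (∀ v ∈ N s, P v = 0 → v = 0) → (∀ v' ∈ N' t, ∃ v ∈ N s, P v = v') →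
      (∀ (i : ι) (v : V), v ∈ N s → P (T i v) = T i (P v)) → False) :
    (⨆ s, N s) ⊓ (⨆ t, N' t) = ⊥ := by
  by_contra hne
  have hXst := stable_inf T (stable_iSup T N hNst) (stable_iSup T N' hN'st)
  haveI : FiniteDimensional ℚ ↥((⨆ s, N s) ⊓ (⨆ t, N' t)) :=
    Submodule.finiteDimensional_of_le (inf_le_left : (⨆ s, N s) ⊓ (⨆ t, N' t) ≤ ⨆ s, N s)
  obtain ⟨M, hMX, hM0, hMst, hMirr⟩ := exists_irreducible_le_of_stable T hXst hne
  haveI : FiniteDimensional ℚ M := Submodule.finiteDimensional_of_le hMX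
  obtain ⟨s₀, hs₀, P₁, hP₁M, hP₁inj, hP₁surj, hP₁eq⟩ :=
    exists_iso_of_irreducible_le_iSup T hNst hNirr hMst hMirr hM0 (hMX.trans inf_le_left)
  obtain ⟨t₀, -, P₂, hP₂M, hP₂inj, hP₂surj, hP₂eq⟩ :=
    exists_iso_of_irreducible_le_iSup T hN'st hN'irr hMst hMirr hM0 (hMX.trans inf_le_right)
  obtain ⟨P₂', hP₂'N, hP₂'inj, hP₂'surj, hP₂'eq, -, -⟩ :=
    exists_inverse_of_iso T P₂ (hN'st t₀) hP₂M hP₂inj hP₂surj hP₂eq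
  refine hsep s₀ t₀ hs₀ (P₂' ∘ₗ P₁) (fun v hv => hP₂'N _ (hP₁M v hv))
    (fun v hv h0 => hP₁inj v hv (hP₂'inj _ (hP₁M v hv) h0)) (fun v' hv' => ?_) (fun i v hv => ?_)
  · obtain ⟨m, hm, hm'⟩ := hP₂'surj v' hv'
    obtain ⟨v, hv, rfl⟩ := hP₁surj m hm
    exact ⟨v, hv, hm'⟩
  · rw [LinearMap.comp_apply, LinearMap.comp_apply, hP₁eq i v hv, hP₂'eq i _ (hP₁M v hv)]

end Summit.HodgeConjecture.CorCM.IrrOdd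

end
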